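import Summits.ResolutionOfSingularities.ResolutionOfSingularities.Theorems.MarkedTransferCampaignW24ReducedRunDeath
import Summits.ResolutionOfSingularities.ResolutionOfSingularities.Theorems.MarkedTransferCampaignW24ReducedBridgeExhaust
import Summits.ResolutionOfSingularities.ResolutionOfSingularities.Theorems.Rescue.RedesignHFlatStarRechoice
import HarnessLib

/-!
# From the `p = 2` death theorem to the rescue currency: `Rescue.CarrierStaysInBox 2 1 (Φ G₀)` for every finitely supported `G₀`
# with bottom digit `≥ 2` (HIRONAKA-L, §9 kernel support; OURS; one-variable REDUCED MODEL of slot W2.4 ↔ the RD-2 / RD-2′ exit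
# clause E3 read at one carrier, cell `res-hironaka`; companion of `MarkedTransferCampaignW24ReducedRunDeath.lean` (same author))

**HONEST FRAMING.** OURS throughout: kernel theorems connecting OURS objects of the cell — res-L1-k24's reduced universal / canonical
runs (`CampaignW24.ReducedRun`, p508772 / p509286), res-D-pv-020's reduced ↔ multivariate bridge (`CampaignW24.ReducedBridge`, twin
carrier `Φ G = x·G(x²)`), and res-rescue-typ-2's per-carrier reading of the exit clause `Rescue.CarrierStaysInBox` (p519743). Nothing
below is a statement of H. Hironaka's manuscript *Resolution of singularities in positive characteristics* [Hironaka2017] (lit key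
`paper:url-3343fd9e678b`), nothing asserts that any statement of it holds, nothing is a claim about resolution of singularities in
characteristic `p`, nothing is a verdict word. The manuscript stays «under review» (D-0012/D-0089). AI work, weaker than expert review.
Written by res-L1-type-o6 (own object 2026-08-27T10:53:20Z, follow-on FILE 3 announced 11:15:06Z).

## What is proved (`K` a field of characteristic `2`)
* `unitPart_eq_C_of_coeff_eq_zero`, `canonStepI_eq_univStep_of_coeff_eq_zero`, `canonRun_eq_univRun_of_bound`: when the supports of all
  states of the universal run lie below `P`, the canonical depth-`P` run IS the universal run (the class unit `u_*` is the constant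
  `coeff_κ G`, so the only legal step is the unit-free one) — EXACT equality, not only `≡ (mod t^P)`.
* **`reduced_exhaustion_of_two_le_order`**: for `G₀` finitely supported with `2 ≤ ord G₀`, at EVERY depth `ℓ` with `2^{ℓ−1}` above the
  uniform support bound of `univRun_eventually_zero_bounded`, the canonical run is exhausted IN THE BOX (states before the death index
  non-zero with `2 ≤ ord < 2^{ℓ−1}`, the death state `= 0`).
* **`carrierStaysInBox_phi_of_two_le_order`**: hence `Rescue.CarrierStaysInBox 2 1 (ReducedBridge.phi G₀)` (res-D-pv-020's
  `ReducedBridge.staysInBox_of_reduced_exhaustion`); `carrierStaysInBox_phi_of_constantCoeff_ne_zero` (bottom digit `0`: the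
  proviso `p^e < ord η` fails, VACUOUS); and **`carrierStaysInBox_phi_coe`** for `G₀ = ↑Q`, `Q ∈ K[t]` with `Q.coeff 1 = 0`.
  This is the `p = 2`, `e = 1`, `n = 1` slice of the OURS premise ⟨`Rescue.FiniteSupportStaysInBox_ours`⟩ ON THE TWIN CARRIERS
  `x·Q(x²)` WITH BOTTOM DIGIT `≠ 1` — by proof; nothing is claimed for bottom digit `1` (Case-(III) first step), for other
  `(p, e, n)`, or for infinite-support carriers (which can escape, `…ReducedBridgeRun.not_staysInBox_of_escape`).
Hypotheses: each theorem's own binders; no FACT-LIST fact, no DEFECT binder; def-free. Host: route MarkedTransfer, item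
`HypersurfaceOrderReduction` (stmt-ResolutionOfSingularities-16155), `--as helper`. Standard axioms only.
-/

noncomputable section

set_option linter.dupNamespace false -- mandated namespace of this single-conjunct summit

namespace Summit.ResolutionOfSingularities.ResolutionOfSingularities.Theorems

namespace CampaignW24

namespace ReducedRun

open PowerSeries

universe u

section CanonEqUniv

variable {K : Type u} [Field K]

/-- If `coeff m G = 0` for all `m ≥ P`, then the class unit at `k` is the constant `coeff k G`. [folklore] -/
theorem unitPart_eq_C_of_coeff_eq_zero {P k : ℕ} {G : K⟦X⟧} (hG : ∀ m, P ≤ m → coeff m G = 0) :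
    unitPart P k G = C (coeff k G) := by
  ext m
  rw [coeff_unitPart, coeff_C]
  by_cases hm : m = 0
  · subst hm; rw [if_pos (dvd_zero P), if_pos rfl, zero_add]
  · rw [if_neg hm]
    split_ifs with hd
    · exact hG _ ((Nat.le_of_dvd (Nat.pos_of_ne_zero hm) hd).trans (Nat.le_add_right m k))
    · rfl

/-- **The canonical step IS the universal step below the box**: if `coeff m G = 0` for all `m ≥ P` (`0 < P`), then
`canonStepI P G = univStep G` — exactly (for `P = 0` the hypothesis forces `G = 0`). [folklore] -/
theorem canonStepI_eq_univStep_of_coeff_eq_zero {P : ℕ} {G : K⟦X⟧} (hG : ∀ m, P ≤ m → coeff m G = 0) :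
    canonStepI P G = univStep G := by
  by_cases hG0 : G = 0
  · subst hG0
    rw [univStep_zero']
    unfold canonStepI stepI
    rw [zero_mul, mul_zero, sub_zero]
  obtain ⟨k, hk⟩ := exists_order_eq_nat hG0
  have ha : coeff k G ≠ 0 := (order_eq_nat.mp hk).1
  set a := coeff k G with hadef
  have hu : unitPart P k G = C a := unitPart_eq_C_of_coeff_eq_zero hG
  have hinv : (unitPart P k G)⁻¹ = C a⁻¹ := by
    rw [hu]
    symm
    refine eq_inv_of_mul_eq_one (by rwa [constantCoeff_C]) ?_
    rw [← map_mul, inv_mul_cancel₀ ha, map_one]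
  have h1 : C a⁻¹ * C a = (1 : K⟦X⟧) := by rw [← map_mul, inv_mul_cancel₀ ha, map_one]
  unfold canonStepI univStep univStepI
  rw [hk, ENat.toNat_coe, hinv]
  unfold stepI
  have hD : D k (G - C a * X ^ k) = D k G - C a := by
    rw [map_sub, ← smul_eq_C_mul, LinearMap.map_smul, D_X_pow_self, smul_eq_C_mul, mul_one]
  rw [hD]
  linear_combination (-G) * h1

/-- **The canonical depth-`P` run IS the universal run** as long as every state's support lies below `P`. [folklore] -/
theorem canonRun_eq_univRun_of_bound {P : ℕ} {G₀ : K⟦X⟧}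
    (hbd : ∀ i m, P ≤ m → coeff m (univRun G₀ i) = 0) : ∀ i, canonRun P G₀ i = univRun G₀ i
  | 0 => rfl
  | i + 1 => by
    show canonStepI P (canonRun P G₀ i) = univStep (univRun G₀ i)
    rw [canonRun_eq_univRun_of_bound hbd i]
    exact canonStepI_eq_univStep_of_coeff_eq_zero (hbd i)

end CanonEqUniv

section Exhaustion

variable {K : Type u} [Field K] [CharP K 2]

/-- **In-box reduced exhaustion at every large depth.** For `G₀` finitely supported with `2 ≤ ord G₀` there are a death index `i₁`
and a bound `B⋆` such that for EVERY `P > B⋆`: the canonical depth-`P` states `i < i₁` are non-zero with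
`2 ≤ ord < P`, and the state `i₁` is `0`. [folklore] -/
theorem reduced_exhaustion_of_two_le_order (G₀ : K⟦X⟧) (hfin : ∃ B : ℕ, ∀ m, B < m → coeff m G₀ = 0)
    (h2 : (2 : ℕ∞) ≤ order G₀) :
    ∃ i₁ Bstar : ℕ, ∀ P : ℕ, Bstar < P →
      (∀ i < i₁, canonRun P G₀ i ≠ 0 ∧ (2 : ℕ∞) ≤ order (canonRun P G₀ i) ∧ order (canonRun P G₀ i) < (P : ℕ∞)) ∧
        canonRun P G₀ i₁ = 0 := by
  classical
  obtain ⟨B, hB⟩ := hfin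
  obtain ⟨N, Bstar, hN, hbd⟩ := univRun_eventually_zero_bounded _ G₀ B hB le_rfl
  have hex : ∃ i, univRun G₀ i = 0 := ⟨N, hN⟩
  refine ⟨Nat.find hex, Bstar, fun P hP => ?_⟩
  have hbd' : ∀ i m, P ≤ m → coeff m (univRun G₀ i) = 0 := fun i m hm => hbd i m (by omega)
  have heq := canonRun_eq_univRun_of_bound hbd'
  refine ⟨fun i hi => ?_, by rw [heq]; exact Nat.find_spec hex⟩
  have hne : univRun G₀ i ≠ 0 := Nat.find_min hex hi
  rw [heq]
  refine ⟨hne, h2.trans (order_le_order_univRun G₀ i hne), ?_⟩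
  obtain ⟨k, hk⟩ := exists_order_eq_nat hne
  have hkc : coeff k (univRun G₀ i) ≠ 0 := (order_eq_nat.mp hk).1
  have hkB : k ≤ Bstar := by
    by_contra hlt
    exact hkc (hbd i k (by omega))
  rw [hk]
  exact_mod_cast lt_of_le_of_lt hkB hP

end Exhaustion

end ReducedRun

namespace ReducedBridge

open Literature.AlgebraicGeometry.Hironaka2017.S08UnitMonomial (StandardExpression)
open Literature.AlgebraicGeometry.Hironaka2017.S09LLUED
open Literature.AlgebraicGeometry.Hironaka2017.S09LLUED.TopFrontier
open Literature.AlgebraicGeometry.Resolution (adicOrder)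
open Literature.RingTheory.MvPowerSeries (adicOrder_eq_order)
open CampaignW21 (xs)

variable {K : Type} [Field K] [CharP K 2]

/-- **`StaysInBox` at every large depth for the twin carrier `Φ G₀`**, `G₀` finitely supported with `2 ≤ ord G₀`: there is `ℓ₁` such
that `StaysInBox 2 1 ℓ X₀` for every `ℓ ≥ ℓ₁` and every reference datum `X₀` of `Φ G₀` (res-D-pv-020's bridge applied to the
reduced exhaustion). [folklore] -/
theorem staysInBox_phi_eventually (G₀ : PowerSeries K) (hfin : ∃ B : ℕ, ∀ m, B < m → PowerSeries.coeff m G₀ = 0)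
    (h2 : (2 : ℕ∞) ≤ PowerSeries.order G₀) :
    ∃ ℓ₁ : ℕ, 1 ≤ ℓ₁ ∧ ∀ ℓ, ℓ₁ ≤ ℓ → ∀ {ℓ₀ : ℕ} (X₀ : StandardExpression 2 (xs K 1) 1 ℓ₀ (phi G₀)), StaysInBox 2 1 ℓ X₀ := by
  obtain ⟨i₁, Bstar, h⟩ := ReducedRun.reduced_exhaustion_of_two_le_order G₀ hfin h2
  refine ⟨Bstar + 1, by omega, fun ℓ hℓ ℓ₀ X₀ => ?_⟩
  have hP : Bstar < 2 ^ (ℓ - 1) := lt_of_lt_of_le (Nat.lt_two_pow_self) (Nat.pow_le_pow_right two_pos (by omega))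
  obtain ⟨hpre, hzero⟩ := h (2 ^ (ℓ - 1)) hP
  exact staysInBox_of_reduced_exhaustion (by omega) X₀ rfl
    (fun i hi => ⟨(hpre i hi).1, (hpre i hi).2.1, by exact_mod_cast (hpre i hi).2.2⟩) hzero

/-- **`Rescue.CarrierStaysInBox 2 1 (Φ G₀)` — the exit clause E3 read at the twin carrier `x·G₀(x²)`, for every finitely supported
`G₀ ∈ K⟦t⟧` with bottom digit `≥ 2`, every field `K` of characteristic `2`** (`[ExpChar K 2] [PerfectRing K 2]` are binders of the
OURS def, unused by the proof). The `p = 2 / e = 1 / n = 1` slice of ⟨`Rescue.FiniteSupportStaysInBox_ours`⟩ on these carriers, by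
proof. [folklore] -/
theorem carrierStaysInBox_phi_of_two_le_order [ExpChar K 2] [PerfectRing K 2] (G₀ : PowerSeries K)
    (hfin : ∃ B : ℕ, ∀ m, B < m → PowerSeries.coeff m G₀ = 0) (h2 : (2 : ℕ∞) ≤ PowerSeries.order G₀) :
    Rescue.CarrierStaysInBox 2 1 (phi G₀) := by
  obtain ⟨ℓ₁, -, hℓ₁⟩ := staysInBox_phi_eventually G₀ hfin h2
  intro ℓ₀ X₀ _ _ _ _ _
  exact ⟨max ℓ₀ ℓ₁, le_max_left _ _, hℓ₁ _ (le_max_right _ _) X₀⟩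

omit [CharP K 2] in
/-- **Bottom digit `0` is VACUOUS**: if `G₀(0) ≠ 0` then `Φ G₀ = x·G₀(x²)` has order `1 < 2 = p^e`, so the proviso
`p^e < adicOrder η` of the exit clause fails and `Rescue.CarrierStaysInBox 2 1 (Φ G₀)` holds trivially. [folklore] -/
theorem carrierStaysInBox_phi_of_constantCoeff_ne_zero [CharP K 2] [ExpChar K 2] [PerfectRing K 2] (G₀ : PowerSeries K)
    (h0 : PowerSeries.constantCoeff G₀ ≠ 0) : Rescue.CarrierStaysInBox 2 1 (phi G₀) := by
  intro ℓ₀ X₀ _ _ _ _ hord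
  exfalso
  rw [adicOrder_eq_order] at hord
  have hc : MvPowerSeries.coeff (Finsupp.single 0 (2 * 0 + 1)) (phi G₀) ≠ 0 := by
    rw [coeff_phi_two_mul_add_one, PowerSeries.coeff_zero_eq_constantCoeff_apply]
    exact h0
  have hle := MvPowerSeries.order_le hc
  rw [Finsupp.degree_single] at hle
  have h21 : ((2 ^ 1 : ℕ) : ℕ∞) < ((2 * 0 + 1 : ℕ) : ℕ∞) := lt_of_lt_of_le hord hle
  exact absurd (by exact_mod_cast h21 : (2 ^ 1 : ℕ) < 2 * 0 + 1) (by norm_num)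

/-- **Polynomial form**: for `Q ∈ K[t]` with `Q.coeff 1 = 0` — bottom digit `≠ 1`: digit `0` is vacuous
(`carrierStaysInBox_phi_of_constantCoeff_ne_zero`), digit `≥ 2` is the death theorem — `Rescue.CarrierStaysInBox 2 1 (Φ ↑Q)`.
The one EXCLUDED shape is bottom digit exactly `1` (`Q(0) = 0 ≠ Q'(0)`: Case-(III) first step, not claimed). [folklore] -/
theorem carrierStaysInBox_phi_coe [ExpChar K 2] [PerfectRing K 2] (Q : Polynomial K) (h1 : Q.coeff 1 = 0) :
    Rescue.CarrierStaysInBox 2 1 (phi (Q : PowerSeries K)) := by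
  by_cases h0 : Q.coeff 0 = 0
  · refine carrierStaysInBox_phi_of_two_le_order _ ⟨Q.natDegree, fun m hm => ?_⟩ ?_
    · rw [Polynomial.coeff_coe]
      exact Polynomial.coeff_eq_zero_of_natDegree_lt hm
    · refine PowerSeries.nat_le_order _ _ fun i hi => ?_
      rw [Polynomial.coeff_coe]
      interval_cases i
      · exact h0
      · exact h1
  · refine carrierStaysInBox_phi_of_constantCoeff_ne_zero _ ?_
    rwa [← PowerSeries.coeff_zero_eq_constantCoeff_apply, Polynomial.coeff_coe]

end ReducedBridge

end CampaignW24

end Summit.ResolutionOfSingularities.ResolutionOfSingularities.Theorems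

end
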